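import Mathlib
import Summits.NavierStokesRegularity.FluidComputer.TransportGalerkinHeadTail
import HarnessLib

/-!
# Head blocks on the phase space `E` from a finite matrix of mode-to-mode operators (instab g18, cell `ns-blowup`, 2026-08-27)

HONEST FRAMING (human ruling D-0035): nothing here is a claim about Navier–Stokes blow-up.
WHAT THIS IS NOT: not NS evidence — plumbing for certificate holders (`HOME/instab/BETA2-SPEC.md`
§11): the head block `H : E →L[ℝ] E` of a «head ⊕ tail» weight (`TransportGalerkinHeadTail`) built
from a FINITE MATRIX of bounded real-linear maps `B k l : V →L[ℝ] V` between the coefficient spaces of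
the modes `k, l` of the cube `|k|_∞ ≤ K` — the shape in which a Lyapunov / Gram matrix on the
truncated modes is transported to `E = ℓ²(ℤ^d; V)`. General finite `d`, Hilbert `V`.

* `exists_evalCLM` / `exists_singleCLM` — coordinate evaluation `x ↦ x l` and the single-mode
  embedding `v ↦ lp.single 2 k v` as bounded real-linear maps;
* **`exists_headCLM`** — `∃ H : E →L[ℝ] E`, `(H x)(k) = Σ_{l ∈ cube K} B k l (x l)` on the cube and `0`
  off it;
* `inner_head_eq_sum` — `⟪H x, y⟫ = Σ_{k,l ∈ cube K} ⟪B k l (x l), y k⟫` (a finite double sum: the matrix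
  quadratic form); `head_symm` — `H` is symmetric when `⟪B k l v, w⟫ = ⟪v, B l k w⟫`;
* `head_cubeProj` — `H (P_K x) = H x` and `P_K (H x) = H x`, so `H = P_K ∘ H ∘ P_K` and the lemmas of
  `TransportGalerkinHeadTail` apply with this `H` verbatim (`headTail_of_head`).

Mathlib + the tree files cited; no new definitions.
-/

noncomputable section

namespace Summit.NavierStokesRegularity.FluidComputer.TransportGalerkinHeadBlock

open Set Filter Topology Finset RCLike
open Literature.Analysis.FunctionSpaces Literature.Analysis.FunctionSpaces.Lattice
open Literature.Analysis.FunctionSpaces.Torus Literature.Analysis.ODE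
open Summit.NavierStokesRegularity.FluidComputer.GalerkinLatticePhaseSpace
open Summit.NavierStokesRegularity.FluidComputer.TransportGalerkin
open Summit.NavierStokesRegularity.FluidComputer.TransportGalerkinBox
open scoped ENNReal NNReal ComplexConjugate InnerProductSpace

variable {d : Type*} [Fintype d] [DecidableEq d]
variable {V : Type*} [NormedAddCommGroup V] [InnerProductSpace ℂ V] [CompleteSpace V]

/-! ## §1 Coordinate evaluation and single-mode embedding as bounded maps -/

omit [Fintype d] [DecidableEq d] [InnerProductSpace ℂ V] [CompleteSpace V] in
/-- **Coordinate evaluation** `x ↦ x l` is a bounded real-linear map `E → V` (norm `≤ 1`). -/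
theorem exists_evalCLM [NormedSpace ℂ V] (l : d → ℤ) :
    ∃ ev : lp (fun _ : (d → ℤ) => V) 2 →L[ℝ] V, ∀ x, ev x = x l :=
  ⟨LinearMap.mkContinuous
      { toFun := fun x => x l
        map_add' := fun x y => by rw [lp.coeFn_add, Pi.add_apply]
        map_smul' := fun r x => by rw [lp.coeFn_smul, Pi.smul_apply, RingHom.id_apply] } 1
      fun x => by rw [one_mul]; exact lp.norm_apply_le_norm (by norm_num) x l,
    fun x => rfl⟩

omit [DecidableEq d] [InnerProductSpace ℂ V] [CompleteSpace V] in
/-- **Single-mode embedding** `v ↦ lp.single 2 k v` is a bounded real-linear map `V → E` (an isometry). -/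
theorem exists_singleCLM [NormedSpace ℂ V] (k : d → ℤ) :
    ∃ sg : V →L[ℝ] lp (fun _ : (d → ℤ) => V) 2, ∀ v, sg v = lp.single 2 k v :=
  ⟨LinearMap.mkContinuous ((lp.lsingle (E := fun _ : (d → ℤ) => V) (𝕜 := ℝ) 2 k)) 1
      fun v => by
        rw [one_mul, show (lp.lsingle (E := fun _ : (d → ℤ) => V) (𝕜 := ℝ) 2 k) v = lp.single 2 k v from rfl,
          lp.norm_single (by norm_num)],
    fun v => rfl⟩

/-! ## §2 The head block of a finite matrix -/

omit [InnerProductSpace ℂ V] [CompleteSpace V] in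
/-- **A finite matrix of mode-to-mode operators defines a head block on `E`**: for
`B k l : V →L[ℝ] V` there is `H : E →L[ℝ] E` with `(H x)(k) = Σ_{l ∈ cube K} B k l (x l)` for `k` in
the cube `K` and `(H x)(k) = 0` otherwise. -/
theorem exists_headCLM [NormedSpace ℂ V] (K : ℕ) (B : (d → ℤ) → (d → ℤ) → (V →L[ℝ] V)) :
    ∃ H : lp (fun _ : (d → ℤ) => V) 2 →L[ℝ] lp (fun _ : (d → ℤ) => V) 2,
      ∀ x k, (H x : (d → ℤ) → V) k =
        if k ∈ Fintype.piFinset (fun _ : d => Finset.Icc (-(K : ℤ)) K) then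
          ∑ l ∈ Fintype.piFinset (fun _ : d => Finset.Icc (-(K : ℤ)) K), B k l (x l) else 0 := by
  choose ev hev using fun l : d → ℤ =>
    (exists_evalCLM l : ∃ ev : lp (fun _ : (d → ℤ) => V) 2 →L[ℝ] V, ∀ x, ev x = x l)
  choose sg hsg using fun k : d → ℤ =>
    (exists_singleCLM k : ∃ sg : V →L[ℝ] lp (fun _ : (d → ℤ) => V) 2, ∀ v, sg v = lp.single 2 k v)
  refine ⟨∑ k ∈ Fintype.piFinset (fun _ : d => Finset.Icc (-(K : ℤ)) K),
    ∑ l ∈ Fintype.piFinset (fun _ : d => Finset.Icc (-(K : ℤ)) K), (sg k).comp ((B k l).comp (ev l)),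
    fun x k' => ?_⟩
  simp only [FunLike.coe_sum, Finset.sum_apply, lp.coeFn_sum, ContinuousLinearMap.comp_apply,
    hsg, hev, lp.single_apply, Pi.single_apply]
  by_cases hk' : k' ∈ Fintype.piFinset (fun _ : d => Finset.Icc (-(K : ℤ)) K)
  · rw [if_pos hk']
    rw [Finset.sum_eq_single k' (fun k _ hne => by simp [Ne.symm hne]) (fun h => (h hk').elim)]
    simp
  · rw [if_neg hk']
    exact Finset.sum_eq_zero fun k hk => Finset.sum_eq_zero fun l _ => by
      rw [if_neg]
      rintro rfl
      exact hk' hk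

variable {K : ℕ} {B : (d → ℤ) → (d → ℤ) → (V →L[ℝ] V)}
  {H : lp (fun _ : (d → ℤ) => V) 2 →L[ℝ] lp (fun _ : (d → ℤ) => V) 2}

omit [CompleteSpace V] in
/-- **The head block's pairing is the matrix quadratic form**:
`⟪H x, y⟫ = Σ_{k ∈ cube K} Σ_{l ∈ cube K} ⟪B k l (x l), y k⟫`. -/
theorem inner_head_eq_sum
    (hH : ∀ x k, (H x : (d → ℤ) → V) k =
      if k ∈ Fintype.piFinset (fun _ : d => Finset.Icc (-(K : ℤ)) K) then
        ∑ l ∈ Fintype.piFinset (fun _ : d => Finset.Icc (-(K : ℤ)) K), B k l (x l) else 0)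
    (x y : lp (fun _ : (d → ℤ) => V) 2) :
    ⟪H x, y⟫_ℂ = ∑ k ∈ Fintype.piFinset (fun _ : d => Finset.Icc (-(K : ℤ)) K),
      ∑ l ∈ Fintype.piFinset (fun _ : d => Finset.Icc (-(K : ℤ)) K), ⟪B k l (x l), y k⟫_ℂ := by
  rw [lp.inner_eq_tsum, tsum_eq_sum (s := Fintype.piFinset (fun _ : d => Finset.Icc (-(K : ℤ)) K))
    (fun k hk => by rw [hH, if_neg hk, inner_zero_left])]
  refine Finset.sum_congr rfl fun k hk => ?_
  rw [hH, if_pos hk, sum_inner]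

omit [CompleteSpace V] in
/-- **The head block is symmetric when the matrix is**: `⟪B k l v, w⟫ = ⟪v, B l k w⟫ ⇒ ⟪H x, y⟫ = ⟪x, H y⟫`. -/
theorem head_symm
    (hH : ∀ x k, (H x : (d → ℤ) → V) k =
      if k ∈ Fintype.piFinset (fun _ : d => Finset.Icc (-(K : ℤ)) K) then
        ∑ l ∈ Fintype.piFinset (fun _ : d => Finset.Icc (-(K : ℤ)) K), B k l (x l) else 0)
    (hB : ∀ k l (v w : V), ⟪B k l v, w⟫_ℂ = ⟪v, B l k w⟫_ℂ) (x y : lp (fun _ : (d → ℤ) => V) 2) :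
    ⟪H x, y⟫_ℂ = ⟪x, H y⟫_ℂ := by
  rw [← inner_conj_symm x (H y), inner_head_eq_sum hH, inner_head_eq_sum hH, map_sum, Finset.sum_comm]
  refine Finset.sum_congr rfl fun l _ => ?_
  rw [map_sum]
  refine Finset.sum_congr rfl fun k _ => ?_
  rw [inner_conj_symm, hB]

omit [CompleteSpace V] in
/-- **The head block lives on the cube**: `H (P_K x) = H x` and `P_K (H x) = H x`. -/
theorem head_cubeProj
    (hH : ∀ x k, (H x : (d → ℤ) → V) k =
      if k ∈ Fintype.piFinset (fun _ : d => Finset.Icc (-(K : ℤ)) K) then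
        ∑ l ∈ Fintype.piFinset (fun _ : d => Finset.Icc (-(K : ℤ)) K), B k l (x l) else 0)
    (x : lp (fun _ : (d → ℤ) => V) 2) :
    H (cubeProj K x) = H x ∧ cubeProj K (H x) = H x := by
  constructor
  · refine lp.ext (funext fun k => ?_)
    rw [hH, hH]
    split_ifs with hk
    · exact Finset.sum_congr rfl fun l hl => by rw [cubeProj_apply, if_pos hl]
    · rfl
  · refine lp.ext (funext fun k => ?_)
    rw [cubeProj_apply, hH]
    split_ifs <;> rfl

omit [CompleteSpace V] in
/-- Hence `G := H + D` is a head∣tail weight in the sense of `TransportGalerkinHeadTail`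
(`G w = P_K (H (P_K w)) + D w`). -/
theorem headTail_of_head
    (hH : ∀ x k, (H x : (d → ℤ) → V) k =
      if k ∈ Fintype.piFinset (fun _ : d => Finset.Icc (-(K : ℤ)) K) then
        ∑ l ∈ Fintype.piFinset (fun _ : d => Finset.Icc (-(K : ℤ)) K), B k l (x l) else 0)
    (D : lp (fun _ : (d → ℤ) => V) 2 →L[ℝ] lp (fun _ : (d → ℤ) => V) 2) (w : lp (fun _ : (d → ℤ) => V) 2) :
    (H + D) w = cubeProj K (H (cubeProj K w)) + D w := by
  rw [show (H + D) w = H w + D w from rfl, (head_cubeProj hH w).1.symm, (head_cubeProj hH (cubeProj K w)).2]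

end Summit.NavierStokesRegularity.FluidComputer.TransportGalerkinHeadBlock

end
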